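import Summits.CriticalPhenomena.SAWScalingLimit.Theses.SAWTipEnvironment
import Literature.Probability.RandomPlanarGeometry.KestenTwoSidedSAW
import Literature.Probability.RandomPlanarGeometry.TipNormalisedUniformizer

/-!
# Birth skeleton (BC3, `Lines/birth.lean`) for the crux `SAWTipEnvironment.MartingaleCorrector`

Crux item stmt-CriticalPhenomena-16037 (rank 2, the deciding crux of
`route-CriticalPhenomena-SAWTipEnvironment`, sub-problem `CriticalPhenomena/SAWScalingLimit`); skeleton
registrar planner-skel-stmt-CriticalPhenomena-16037-0, 2026-08-17; tree path
`Summits/CriticalPhenomena/SAWScalingLimit/Cruxes/MartingaleCorrector/Lines/birth.lean`.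

Crux (FIXED, concluded BY NAME below): `MartingaleCorrector` —
`(∃ μ, <Kesten two-sided SAW μ, bulk local limit of the critical chordal SAW>) → ∃ κ ∈ (0,4), ∀ (D; a, b),
endpoint approximation, chordal uniformizer φ, T, ε > 0, eventually in δ: ∃ M on lattice prefixes, an EXACT
martingale for the slit-partition-function tip kernel p(u|η) = x_c Z_(ηu)(b_δ)/Z_η(b_δ) up to capacity
time T, with SAW.law-mass ≤ ε of the prefixes where |M − ξ_η| > ε, or the predictable bracket is not
within ε of κ·capTime, or a jump exceeds ε`.

## The line — the route header's own TWO-LAYER PLAN, typed over the definition files that have landed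

`MartingaleCorrector ⇐ TipBalanceRate → ChordalTransfer → MWTransformCLT` (route header, "TWO-LAYER PLAN";
informal support item stmt-CriticalPhenomena-16148 `TipBalanceRate`, filed untyped at open because definition
D2 was missing).  Both definition requests are now in the tree:
`Literature/Probability/RandomPlanarGeometry/KestenTwoSidedSAW.lean` (D1: `SAW.KestenTwoSidedSAW`,
`SAW.IsBulkLocalLimitOfCriticalSAW`, the continuation kernel `SAW.stepProb μ`, and the bridge
`SAW.kestenTwoSidedSAW_and_isBulkLocalLimit_iff` unfolding their conjunction into the crux hypothesis) and
`Literature/Probability/RandomPlanarGeometry/TipNormalisedUniformizer.lean` (D2: the whole-plane tip frame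
`LatticePast.uniformizer`, step data `LatticePast.dW / dt / scaleRatio`, the LOEWNER DRIFT
`LatticePast.loewnerDrift p`, clock `LatticePast.loewnerClock p`, transfer operator, projective sums
`LatticePast.projectiveSum p f n = V_n f = Σ_(k<n) Pᵏ f` and the PROJECTIVE NORM
`LatticePast.projectiveNorm p μ f n = ‖V_n f‖_(L²(μ))`).  So the whole-plane engine can be typed, and the
skeleton cuts the crux at its two natural seams — WHOLE PLANE (Kesten's measure `μ` seen from the tip,
kernel `p = SAW.stepProb μ`) versus CHORDAL (the domain walk), and inside the whole plane ODD (cancellation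
of the drift, where conformal covariance lives) versus EVEN (quantitative ergodicity of clock / variance /
scale-ratio moments):

* S1 `stub_driftRate : … → DriftRate μ` (OPEN, conjecture-grade; the card's K1 = (TB), "tip balance at a
  power rate") — for the Loewner drift `b = loewnerDrift p` of Kesten's measure:
  `‖Σ_(k<n) E_μ[b(E_k) | F_0]‖_(L²(μ)) = ‖V_n b‖ ≤ C n^(1/2 − ε₀)` for some `ε₀ > 0` — the Maxwell–Woodroofe
  projective criterion (doi:10.1214/aop/1019160258, (2): `Σ n^(−3/2) ‖V_n g‖ < ∞`) with a power saving.
  It forces `E_μ b = 0` and `b ∈ L²` (n = 1).  Why it might fail (route): a sheared embedding satisfies all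
  else and sits ON the borderline `n^(1/2)`; no rate is known for any SAW tip response.
* S2 `stub_evenHomogenisation : … → EvenHomogenisation μ` (OPEN, conjecture-grade; the even half of (TB):
  "the same power-rate ergodic averaging of the conditional variance and the clock against far-past
  features, and moment bounds on ρ") — integrability of the raw conditional second moment
  `w(E) = Σ_s p(s|E) dW(E,s)²`, of the clock `τ(E) = Σ_s p(s|E) dt(E,s)` and of the log-scale-ratio second
  moment `Σ_s p(s|E) (log ρ(E,s))²`; a NON-DEGENERATE clock `E_μ τ > 0`; and the projective bounds
  `‖V_n (f − E_μ f)‖_(L²(μ)) ≤ C n^(1/2 − ε₀)` for `f ∈ {τ, w}` (Gordin–Maxwell–Woodroofe form, the shape the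
  in-octave homogenisation of the bracket consumes).  Why it might fail: a rate for E[f(E_k) | F_0] → E f
  is a mixing statement for the SAW seen from its tip; none is in print (Kesten's pattern theorem is
  rate-free; Madras–Slade §7).
* S3 `stub_chordalTransfer : … → DriftRate μ → EvenHomogenisation μ → CorrectorConclusion` (XL, HARDEST as a
  proof obligation; = ChordalTransfer + MWTransformCLT of the plan) — from Kesten's measure as bulk local
  limit plus S1/S2-type whole-plane input, the CHORDAL corrector: (i) Gordin/Kipnis–Varadhan/
  Maxwell–Woodroofe/Peligrad–Utev martingale(-transform) approximation on the stationary tip chain with the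
  multiplicatively predictable scale cocycle `c_k = Π ρ` (whole-plane corrector `u`, KV diffusivity
  `κ = E_μ[ṽ]/E_μ[τ]`, `ṽ` the conditional variance of the corrected increment); (ii) local equilibrium of
  bulk tips of the chordal walk in `D_δ` (this is where `IsBulkLocalLimitOfCriticalSAW` is consumed) and the
  comparison chordal frame / tip frame (hydrodynamic vs tip normalisation), negligibility of the boundary-
  and target-induced conditional drift and of the capacity spent near `∂D`; (iii) the numerical window
  `0 < κ < 4` (expected `κ = 8/3`, Kennedy2008Driving; `κ < 4` is what `DrivingIdentification` needs).
  Its conclusion `CorrectorConclusion` is the crux's conclusion VERBATIM.  Why it might fail (route, item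
  CorrectorPassage): clock matching and moment control of `ρ` at fjord-trapped tips; the transform CLT with
  rough multipliers is not in print in the needed maximal form.

Composition (kernel-checked, sorry-free): `stubComposition : S1-sig → S2-sig → S3-sig → MartingaleCorrector`
— unpack the crux hypothesis `∃ μ, …` through `SAW.kestenTwoSidedSAW_and_isBulkLocalLimit_iff`, install
`IsProbabilityMeasure μ` from `KestenTwoSidedSAW.isProbabilityMeasure`, and apply S3 to S1, S2 (modus
ponens; the seam is trivial BY DESIGN: all content sits in three named, typed, independent obligations).
`MartingaleCorrector_of : MartingaleCorrector` is `stubComposition` fed with the three `stub_*` BY NAME.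

## Remarks for the lead / strategist (not obligations)

* S3 bundles three things, see (i)–(iii); the natural depth-2 resplit once a `kvDiffusivity μ` definition
  lands is `S3 ⇐ WholePlaneInvariance(κ(μ)) → KappaWindow(κ(μ) < 4) → ChordalLocalEquilibrium`.
* PREDICTABLE-BRACKET INFLATION (observed while typing; recorded in `Lines/birth.md`): the crux measures the
  PREDICTABLE bracket `Σ_k Σ_u p(u|η_k)(ΔM)²`.  Given one exact martingale `M₀` with the corrector property
  at `κ₀`, adding the Doob martingale of `Σ_k A_k·𝟙(rare pattern k)` (rare multi-step patterns of
  conditional probability `q_k`, `A_k² q_k ≍ c·Δcap_k`) changes paths by `o(1)` in probability but adds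
  `≈ c·capTime` to the predictable bracket; so the property at `κ₀` plausibly implies it at every
  `κ ∈ [κ₀, 4)`.  This does not bear on the truth of THIS crux (∃ κ), but it means the lattice hypothesis of
  `CorrectorPassage` (stmt-16039) is satisfiable with inflated κ unless a uniform-integrability / realised-
  quadratic-variation clause is added — worth a refuter's look at 16039, and worth keeping in mind when S3
  is proved (prove it for the KV value, with UI of `M²` as a by-product).

## Disproof used
None on file: `ledger crux ls stmt-CriticalPhenomena-16037` showed no workfiles (no `Disproof.lean`, no
`Negative/` lemmas) at registration time; `ledger negatives --problem CriticalPhenomena`: no statement about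
tip kernels, Kesten's measure or driving-function martingales (the refuted all-δ `Tight`, stmt-0772, is not
touched — the route uses `EventualTight`).

## Checks (registrar folder `bc/`)
`lean check --json bc/MartingaleCorrector_birth.lean`: rc 0, errors [], sorries 3 = the three `stub_*`
(zero elsewhere; `stubComposition` and the statement abbrevs are sorry-free, `MartingaleCorrector_of` only
inherits the stubs').  BC3 probes `bc/probe_<stub>_{crux,summit}.lean`: hypothesis = the stub signature
verbatim, goal = the crux BY NAME, resp. `_root_.SAWScalingLimit`, tactic
`first | exact? | simpa using h | aesop` under `maxHeartbeats 400000`: all 6 FAIL (details in `Lines/birth.md`).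
-/

noncomputable section

namespace Summit.CriticalPhenomena.SAWScalingLimit.Cruxes.MartingaleCorrector.Birth

open scoped BigOperators Topology ENNReal NNReal MeasureTheory ProbabilityTheory
open Filter Set MeasureTheory

/-! ## Typed whole-plane statements (Kesten's measure `μ` seen from the tip; kernel `p = SAW.stepProb μ`) -/

/-- **Raw conditional second moment of the driving increment** `w(E) = Σ_s p(s|E) dW(E, s)²` (sum over the
lattice neighbours `s` of the tip `E 0`; `loewnerVariance p E = w(E) − b(E)²` for a kernel of mass one,
`LatticePast.loewnerVariance_eq`). [cite: Kennedy2008Driving, §3] -/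
abbrev stepSecondMoment (p : (ℕ → Literature.Probability.LatticeModels.Site 2) → Literature.Probability.LatticeModels.Site 2 → ℝ) (E : ℕ → Literature.Probability.LatticeModels.Site 2) : ℝ :=
  ∑ s ∈ (Literature.Probability.LatticeModels.zdGraph 2).neighborFinset (E 0), p E s * (Literature.Probability.RandomPlanarGeometry.LatticePast.dW E s) ^ 2

/-- **Log-scale-ratio second moment** `ℓ(E) = Σ_s p(s|E) (log ρ(E, s))²` of the one-step scale ratio
`ρ = LatticePast.scaleRatio` (the multiplicative cocycle relating consecutive tip frames). [folklore] -/
abbrev logScaleMoment (p : (ℕ → Literature.Probability.LatticeModels.Site 2) → Literature.Probability.LatticeModels.Site 2 → ℝ) (E : ℕ → Literature.Probability.LatticeModels.Site 2) : ℝ :=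
  ∑ s ∈ (Literature.Probability.LatticeModels.zdGraph 2).neighborFinset (E 0), p E s * (Real.log (Literature.Probability.RandomPlanarGeometry.LatticePast.scaleRatio E s)) ^ 2

/-- **(TB, odd part) Tip balance at a power rate.**  For the Loewner drift `b = loewnerDrift p`,
`p = SAW.stepProb μ`: `‖V_n b‖_(L²(μ)) ≤ C · n^(1/2 − ε₀)` for some `ε₀ > 0`, `C`, all `n`
(`V_n b = Σ_(k<n) Pᵏ b = E_μ[Σ_(k<n) b(E_k) | F_0]`; Maxwell–Woodroofe's projective criterion with a power
saving; at `n = 1` it contains `b ∈ L²(μ)`, and it forces `E_μ b = 0`).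
[cite: MaxwellWoodroofe2000, p. 714 (2)] -/
abbrev DriftRate (μ : MeasureTheory.Measure (ℤ → Literature.Probability.LatticeModels.Site 2)) [MeasureTheory.IsFiniteMeasure μ] : Prop :=
  ∃ ε₀ : ℝ, 0 < ε₀ ∧ ∃ C : ℝ, ∀ n : ℕ,
    Literature.Probability.RandomPlanarGeometry.LatticePast.projectiveNorm (Literature.Probability.RandomPlanarGeometry.SAW.stepProb μ) μ
        (Literature.Probability.RandomPlanarGeometry.LatticePast.loewnerDrift (Literature.Probability.RandomPlanarGeometry.SAW.stepProb μ)) n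
      ≤ ENNReal.ofReal (C * (n : ℝ) ^ ((1 : ℝ) / 2 - ε₀))

/-- **(TB, even part) Power-rate homogenisation of the clock and the conditional second moment, and
moments of the scale ratio.**  With `p = SAW.stepProb μ`, `E = LatticePast.ofBiInfinite ω` the past seen from
the tip, `τ = loewnerClock p`, `w = stepSecondMoment p`, `ℓ = logScaleMoment p`:
(a) `w ∘ E`, `τ ∘ E`, `ℓ ∘ E` are `μ`-integrable; (b) the clock is non-degenerate, `E_μ[τ ∘ E] > 0`;
(c) `‖V_n (f − E_μ[f ∘ E])‖_(L²(μ)) ≤ C · n^(1/2 − ε₀)` for `f ∈ {τ, w}`, some `ε₀ > 0`, `C`, all `n`.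
[cite: MaxwellWoodroofe2000, p. 714 (2)] -/
abbrev EvenHomogenisation (μ : MeasureTheory.Measure (ℤ → Literature.Probability.LatticeModels.Site 2)) [MeasureTheory.IsFiniteMeasure μ] : Prop :=
  MeasureTheory.Integrable (fun ω : ℤ → Literature.Probability.LatticeModels.Site 2 =>
      stepSecondMoment (Literature.Probability.RandomPlanarGeometry.SAW.stepProb μ) (Literature.Probability.RandomPlanarGeometry.LatticePast.ofBiInfinite ω)) μ ∧
  MeasureTheory.Integrable (fun ω : ℤ → Literature.Probability.LatticeModels.Site 2 =>
      Literature.Probability.RandomPlanarGeometry.LatticePast.loewnerClock (Literature.Probability.RandomPlanarGeometry.SAW.stepProb μ) (Literature.Probability.RandomPlanarGeometry.LatticePast.ofBiInfinite ω)) μ ∧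
  MeasureTheory.Integrable (fun ω : ℤ → Literature.Probability.LatticeModels.Site 2 =>
      logScaleMoment (Literature.Probability.RandomPlanarGeometry.SAW.stepProb μ) (Literature.Probability.RandomPlanarGeometry.LatticePast.ofBiInfinite ω)) μ ∧
  (0 < ∫ ω, Literature.Probability.RandomPlanarGeometry.LatticePast.loewnerClock (Literature.Probability.RandomPlanarGeometry.SAW.stepProb μ) (Literature.Probability.RandomPlanarGeometry.LatticePast.ofBiInfinite ω) ∂μ) ∧
  ∃ ε₀ : ℝ, 0 < ε₀ ∧ ∃ C : ℝ, ∀ n : ℕ,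
    Literature.Probability.RandomPlanarGeometry.LatticePast.projectiveNorm (Literature.Probability.RandomPlanarGeometry.SAW.stepProb μ) μ
        (fun η => Literature.Probability.RandomPlanarGeometry.LatticePast.loewnerClock (Literature.Probability.RandomPlanarGeometry.SAW.stepProb μ) η
          - ∫ ω, Literature.Probability.RandomPlanarGeometry.LatticePast.loewnerClock (Literature.Probability.RandomPlanarGeometry.SAW.stepProb μ) (Literature.Probability.RandomPlanarGeometry.LatticePast.ofBiInfinite ω) ∂μ) n
      ≤ ENNReal.ofReal (C * (n : ℝ) ^ ((1 : ℝ) / 2 - ε₀)) ∧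
    Literature.Probability.RandomPlanarGeometry.LatticePast.projectiveNorm (Literature.Probability.RandomPlanarGeometry.SAW.stepProb μ) μ
        (fun η => stepSecondMoment (Literature.Probability.RandomPlanarGeometry.SAW.stepProb μ) η
          - ∫ ω, stepSecondMoment (Literature.Probability.RandomPlanarGeometry.SAW.stepProb μ) (Literature.Probability.RandomPlanarGeometry.LatticePast.ofBiInfinite ω) ∂μ) n
      ≤ ENNReal.ofReal (C * (n : ℝ) ^ ((1 : ℝ) / 2 - ε₀))

/-- **The crux's conclusion, VERBATIM** (everything after the Kesten hypothesis of
`SAWTipEnvironment.MartingaleCorrector`): one `κ ∈ (0, 4)` and, for every Dobrushin domain, endpoint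
approximation, chordal uniformizer, horizon `T` and `ε > 0`, eventually in `δ`, an exact tip-kernel
martingale `M` on lattice prefixes, `ε`-close to the driving value, with predictable bracket within `ε` of
`κ · capTime` and jumps `≤ ε`, off an event of `SAW.law`-mass `≤ ε`. [cite: Kennedy2008Driving, §3] -/
abbrev CorrectorConclusion : Prop :=
  ∃ κ : NNReal, 0 < κ ∧ κ < 4 ∧ ∀ (D : Literature.Probability.RandomPlanarGeometry.DobrushinDomain) (a b : ℝ → Literature.Probability.LatticeModels.Site 2), Literature.Probability.RandomPlanarGeometry.SAW.IsEndpointApprox D a b → ∀ (φ : Literature.Probability.RandomPlanarGeometry.ConformalEquiv UpperHalfPlane.upperHalfPlaneSet D.carrier), D.IsChordalUniformizing φ → ∀ (T ε : ℝ), 0 < T → 0 < ε → ∀ᶠ δ in nhdsWithin 0 (Set.Ioi 0), let Z : Literature.Probability.LatticeModels.Site 2 → List (Literature.Probability.LatticeModels.Site 2) → ℝ := fun w S => ∑' ω : Literature.Probability.RandomPlanarGeometry.SAW.DomainSAW D.carrier δ w (b δ), if ∀ v ∈ ω.walk.support.tail, v ∉ S then Literature.Probability.RandomPlanarGeometry.SAW.criticalFugacity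 ^ ω.length else 0; let p : List (Literature.Probability.LatticeModels.Site 2) → Literature.Probability.LatticeModels.Site 2 → Literature.Probability.LatticeModels.Site 2 → ℝ := fun S w u => Literature.Probability.RandomPlanarGeometry.SAW.criticalFugacity * Z u (S ++ [u]) / Z w S; ∃ M : List (Literature.Probability.LatticeModels.Site 2) → ℝ, (∀ (γ : Literature.Probability.RandomPlanarGeometry.SAW.DomainSAW D.carrier δ (a δ) (b δ)) (n : ℕ), n < γ.length → Literature.Probability.RandomPlanarGeometry.LatticeSlit.capTime φ (γ.walk.take n) ≤ T → M (γ.walk.take n).support = ∑ᶠ u ∈ {u | (Literature.Probability.LatticeModels.discreteDomainGraph D.carrier δ).Adj (γ.walk.getVert n) u ∧ u ∉ (γ.walk.take n).support}, p (γ.walk.take n).support (γ.walk.getVert n) u * M ((γ.walk.take n).support ++ [u])) ∧ Literature.Probability.RandomPlanarGeometry.SAW.law D.carrier δ (a δ) (b δ) {γ | ∃ n : ℕ, n ≤ γ.length ∧ Literature.Probability.RandomPlanarGeometry.LatticeSlit.capTime φ (γ.walk.take n) ≤ T ∧ (ε < |M (γ.walk.take n).support - Literature.Probability.RandomPlanarGeometry.LatticeSlit.drivingValue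 φ (γ.walk.take n)| ∨ ε < |(∑ k ∈ Finset.range n, ∑ᶠ u ∈ {u | (Literature.Probability.LatticeModels.discreteDomainGraph D.carrier δ).Adj (γ.walk.getVert k) u ∧ u ∉ (γ.walk.take k).support}, p (γ.walk.take k).support (γ.walk.getVert k) u * (M ((γ.walk.take k).support ++ [u]) - M (γ.walk.take k).support) ^ 2) - (κ : ℝ) * Literature.Probability.RandomPlanarGeometry.LatticeSlit.capTime φ (γ.walk.take n)| ∨ (n < γ.length ∧ ε < |M (γ.walk.take (n + 1)).support - M (γ.walk.take n).support|))} ≤ ENNReal.ofReal ε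

/-! ## Registered stubs (`sorry` only here) -/

/-- **S1 `stub_driftRate`** (OPEN, conjecture-grade; the card's K1 = (TB), rank-2 child of the route's
foreseen split).  Under Kesten's two-sided measure realised as the bulk local limit of the critical chordal
SAW, the Loewner drift of the tip chain satisfies the Maxwell–Woodroofe projective criterion with a power
saving: `‖V_n b‖_(L²(μ)) = O(n^(1/2 − ε₀))`.  Why it might fail: this is exactly where conformal covariance
lives — the same combinatorial walk read through a sheared embedding sits on the borderline `n^(1/2)`
(Kennedy2008Driving §2); no rate is known for any SAW tip response (the pattern theorem is rate-free); even
the LERW calibration (arXiv:1802.06667) needs slit-plane harmonic estimates.  Sources: KipnisVaradhan1986,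
doi:10.1214/aop/1019160258, doi:10.1214/009117904000001035, Kennedy2008Driving, LawlerSchrammWerner2004SAW. -/
theorem stub_driftRate :
    ∀ (μ : MeasureTheory.Measure (ℤ → Literature.Probability.LatticeModels.Site 2)) [MeasureTheory.IsProbabilityMeasure μ], Literature.Probability.RandomPlanarGeometry.SAW.KestenTwoSidedSAW μ → Literature.Probability.RandomPlanarGeometry.SAW.IsBulkLocalLimitOfCriticalSAW μ → DriftRate μ := by
  sorry

/-- **S2 `stub_evenHomogenisation`** (OPEN, conjecture-grade; the even half of (TB)).  Under the same
hypotheses: integrability of the conditional second moment of `dW`, of the clock and of `(log ρ)²`; a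
non-degenerate clock; and power-rate projective bounds for the CENTRED clock and second moment (quantitative
ergodicity of the SAW seen from its tip).  Why it might fail: `E_μ[f(E_k) | F_0] → E_μ f` at rate
`k^(−1/2−ε)` in `L²` is a polynomial mixing statement for the infinite SAW seen from the tip, for which
nothing is in print (Madras–Slade 1993 §7: even pattern densities are open); fjord-trapped tips could make
`(log ρ)²` or `w` non-integrable.  Sources: doi:10.1214/aop/1019160258, MadrasSlade1993, Kennedy2008Driving,
LawlerSchrammWerner2004SAW §3.4. -/
theorem stub_evenHomogenisation :
    ∀ (μ : MeasureTheory.Measure (ℤ → Literature.Probability.LatticeModels.Site 2)) [MeasureTheory.IsProbabilityMeasure μ], Literature.Probability.RandomPlanarGeometry.SAW.KestenTwoSidedSAW μ → Literature.Probability.RandomPlanarGeometry.SAW.IsBulkLocalLimitOfCriticalSAW μ → EvenHomogenisation μ := by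
  sorry

/-- **S3 `stub_chordalTransfer`** (XL; = ChordalTransfer + MWTransformCLT of the route's plan; HARDEST as a
proof obligation).  From Kesten's measure as bulk local limit and the whole-plane rates S1/S2: the chordal
corrector conclusion of the crux, verbatim — (i) martingale(-transform) approximation à la Gordin /
Kipnis–Varadhan / Maxwell–Woodroofe / Peligrad–Utev on the stationary tip chain with the scale cocycle
`c_k = Π_(j<k) ρ_j`, KV diffusivity `κ = E_μ[ṽ]/E_μ[τ]`; (ii) local equilibrium of bulk tips of the chordal
walk (consumes `IsBulkLocalLimitOfCriticalSAW`), chordal-vs-tip frame comparison, negligible boundary/target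
drift and boundary capacity; (iii) the window `0 < κ < 4`.  Why it might fail: the transform CLT with rough
multipliers in maximal form is not in print; clock matching and `ρ`-moments at fjord-trapped tips; `κ < 4`
is a numerical fact about `μ` (8/3 expected).  Sources: KipnisVaradhan1986, doi:10.1214/009117904000001035,
Kennedy2008Driving §3, KemppainenSmirnov2017, LawlerSchrammWerner2004SAW. -/
theorem stub_chordalTransfer :
    ∀ (μ : MeasureTheory.Measure (ℤ → Literature.Probability.LatticeModels.Site 2)) [MeasureTheory.IsProbabilityMeasure μ], Literature.Probability.RandomPlanarGeometry.SAW.KestenTwoSidedSAW μ → Literature.Probability.RandomPlanarGeometry.SAW.IsBulkLocalLimitOfCriticalSAW μ → DriftRate μ → EvenHomogenisation μ → CorrectorConclusion := by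
  sorry

/-! ## Composition (kernel-checked, no `sorry`): the three stub signatures imply the crux BY NAME -/

/-- The COMPOSITION STATEMENT (arrow form): the three stub signatures, verbatim, imply
`Summit.CriticalPhenomena.SAWScalingLimit.Theses.SAWTipEnvironment.MartingaleCorrector` BY NAME.  (An `abbrev`, so that the
skeleton audit sees exactly one theorem concluding the crux: `MartingaleCorrector_of`.) -/
abbrev StubComposition : Prop :=
    (∀ (μ : MeasureTheory.Measure (ℤ → Literature.Probability.LatticeModels.Site 2)) [MeasureTheory.IsProbabilityMeasure μ], Literature.Probability.RandomPlanarGeometry.SAW.KestenTwoSidedSAW μ → Literature.Probability.RandomPlanarGeometry.SAW.IsBulkLocalLimitOfCriticalSAW μ → DriftRate μ) →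
    (∀ (μ : MeasureTheory.Measure (ℤ → Literature.Probability.LatticeModels.Site 2)) [MeasureTheory.IsProbabilityMeasure μ], Literature.Probability.RandomPlanarGeometry.SAW.KestenTwoSidedSAW μ → Literature.Probability.RandomPlanarGeometry.SAW.IsBulkLocalLimitOfCriticalSAW μ → EvenHomogenisation μ) →
    (∀ (μ : MeasureTheory.Measure (ℤ → Literature.Probability.LatticeModels.Site 2)) [MeasureTheory.IsProbabilityMeasure μ], Literature.Probability.RandomPlanarGeometry.SAW.KestenTwoSidedSAW μ → Literature.Probability.RandomPlanarGeometry.SAW.IsBulkLocalLimitOfCriticalSAW μ → DriftRate μ → EvenHomogenisation μ → CorrectorConclusion) →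
    Summit.CriticalPhenomena.SAWScalingLimit.Theses.SAWTipEnvironment.MartingaleCorrector

/-- COMPOSITION (sorry-free): unpack the crux hypothesis `∃ μ, …` through
`SAW.kestenTwoSidedSAW_and_isBulkLocalLimit_iff`, install the probability-measure instance, and feed S1, S2
into S3; S3's conclusion is the crux's conclusion verbatim. -/
theorem stubComposition : StubComposition := by
  intro h1 h2 h3 hK
  obtain ⟨μ, hμ⟩ := hK
  obtain ⟨hKes, hBulk⟩ :=
    (Literature.Probability.RandomPlanarGeometry.SAW.kestenTwoSidedSAW_and_isBulkLocalLimit_iff μ).mpr hμ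
  haveI : MeasureTheory.IsProbabilityMeasure μ := hKes.isProbabilityMeasure
  exact h3 μ hKes hBulk (h1 μ hKes hBulk) (h2 μ hKes hBulk)

/-- THE SKELETON THEOREM: the crux `Summit.CriticalPhenomena.SAWScalingLimit.Theses.SAWTipEnvironment.MartingaleCorrector`
BY NAME, from the three declared stubs BY NAME (no hypotheses; `sorry` only inside `stub_*`). -/
theorem MartingaleCorrector_of : Summit.CriticalPhenomena.SAWScalingLimit.Theses.SAWTipEnvironment.MartingaleCorrector :=
  stubComposition stub_driftRate stub_evenHomogenisation stub_chordalTransfer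

end Summit.CriticalPhenomena.SAWScalingLimit.Cruxes.MartingaleCorrector.Birth

end
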